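import Summits.BirchSwinnertonDyer.BirchSwinnertonDyer.Theorems.ByReductionTypeAtTwoAdditiveKatoTransport
import Literature.NumberTheory.EllipticCurves.Kato2004.DivisibilityInputsExceptionalTransportLengthProofs
import Literature.NumberTheory.EllipticCurves.Greenberg1999.CharIdealInvolutionIdealForm
import Literature.NumberTheory.EllipticCurves.Greenberg1999.CharIdealInvolutionBaseChange
import Literature.NumberTheory.EllipticCurves.IwasawaEulerCharProofs
import HarnessLib

/-!
# Route ByReductionTypeAtTwo, crux `AdditiveRankZeroAtTwo` (stmt-BirchSwinnertonDyer-19098) — T20 (a) BY NAME: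
# the `ι`-symmetry of the height-one lengths of `X(E/ℚ_∞)` for the ADDITIVE curve from Greenberg's Thm. 1.14 over `ℚ`
# and over `F = ℚ(i)` for the split-multiplicative twist (the tree's two PRINT facts), given the twist decomposition
# in LENGTH form; and the resulting Kato divisibility at EVERY height-one `𝔮 ∌ 2` with the decomposition as the only
# Selmer-side reading (theorems only)

Seat `bsd-2adic-addL2x` GEN 16 (sequel of `…AdditiveKatoTransport.lean`, p682028). HONEST FRAMING (cell `bsd-2adic`, HUMAN
RULING D-0036/D-0054): theorems CONDITIONAL on named inputs; types-the-object-of; closes none; nothing booked; BSD is not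
proved by any of this.

§1 `map_invol_charIdeal_eq_of_thm114_baseChange`: the IDEAL form `ι(char X_{E}(F_∞)) = char X_E(F_∞)` of the base-change
fact `Greenberg1999.thm114_charIdeal_iota_invariant_splitMult_baseChange` (p666089; generator form), exactly as
`Greenberg1999.map_invol_charIdeal_eq_of_thm114` does for the `F = ℚ` fact. §2 `lengthAt_selmerDual_symm_of_decomposition`:
for a globally minimal `W'` multiplicative at `2` (the twist), a number field `F` over which `W'` is split multiplicative
above `2` (intended: `F = ℚ(i)`), torsion finitely generated dual Selmer data `D_F` (of `W'/F_∞`), `D'` (of `W'/ℚ_∞`), `D`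
(of the additive `W/ℚ_∞`), and the decomposition READING in length form «`ℓ_𝔮(D_F.X) = ℓ_𝔮(D'.X) + ℓ_𝔮(D.X)` at every
height-one `𝔮 ∌ 2`» (T20 (a): restriction along `ℚ(ζ_{2^∞})/ℚ_∞`, `E[2]` irreducible; kernel of its algebra:
`Module.lengthAt_eq_add_of_involution`), the two PRINT facts give **`ℓ_𝔮(D.X) = ℓ_{ι𝔮}(D.X)` at every height-one
`𝔮 ∌ 2`**. §3 `lengthAt_selmerDual_le_of_oddBranchInputs_of_decomposition`: §2 fed into the length-form transport
(`Kato2004.MultDivisibilityInputs.lengthAt_X_le_at_factor_of_lengthAt_symm`): Kato's one-sided main conjecture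
`ℓ_𝔮(X(W/ℚ_∞)) ≤ ℓ_𝔮(Λ/(L̃))` at EVERY height-one `𝔮 ∌ 2` for the additive (−1)-block from {`Kato2004.thm12_4`,
`KatoOddBranchInputsAtTwoNegOneSplitTwist`, `Greenberg1999_thm114_charIdeal_iota_invariant`,
`Greenberg1999.thm114_charIdeal_iota_invariant_splitMult_baseChange`, the decomposition reading, `(ι L̃) = (L̃)`}.

References: [Kato2004Asterisque] Thm. 12.4 (2), 12.5 (3) with (12.5.1), §17.13; [GreenbergLNM1716] Thm. 1.14 (p. 68), §1 (p. 60);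
[Greenberg1989] Thm. 2; [MazurTateTeitelbaum1986Invent] §I.17; memo `run/shared/lean/pub/bsd-2adic/addL2x/VERDICT-19098-addL2x-GEN16.md`.
-/

set_option autoImplicit false
-- the summit's namespace `Summit.BirchSwinnertonDyer.BirchSwinnertonDyer` (Sub = Summit) trips `dupNamespace`
set_option linter.dupNamespace false

noncomputable section

open scoped Classical MatrixGroups ModularForm NumberField

open Field CongruenceSubgroup WeierstrassCurve IsDedekindDomain Literature.NumberTheory.EllipticCurves
  Literature.NumberTheory.EllipticCurves.ModularForms Literature.NumberTheory.EllipticCurves.IwasawaAlgebra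
  Literature.NumberTheory.EllipticCurves.Module

namespace Summit.BirchSwinnertonDyer.BirchSwinnertonDyer.Theorems.AddKatoTwo

universe u

/-! ## §1 Ideal form of the base-change fact -/

/-- `Ideal.map` along the involution as a ring hom or as an algebra hom is the same ideal. [folklore] -/
theorem map_invol_toRingHom_eq {p : ℕ} [Fact p.Prime] (I : Ideal (IwasawaAlgebra p)) :
    I.map (invol p).toRingHom = I.map (invol p) := rfl

/-- **Greenberg, LNM 1716 Thm. 1.14 «for any F», IDEAL form: `ι(char X_E(F_∞)) = char X_E(F_∞)`** for `E = V.baseChange F`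
split multiplicative above `p`, the cyclotomic `ℤ_p`-extension of `F` and a finitely generated torsion dual Selmer datum — from
the tree's generator-form fact `Greenberg1999.thm114_charIdeal_iota_invariant_splitMult_baseChange` (`char X = (f)` principal,
`invol p f = f.subst((1+T)⁻¹ − 1) = u·f`). [cite: GreenbergLNM1716, Thm. 1.14 (p. 68)] [cite: Washington1997, §13.2] -/
theorem map_invol_charIdeal_eq_of_thm114_baseChange
    (h114F : Greenberg1999.thm114_charIdeal_iota_invariant_splitMult_baseChange)
    (F : Type) [Field F] [NumberField F] (V : WeierstrassCurve ℚ) [V.IsElliptic] (p : ℕ) [Fact p.Prime]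
    (hF : ∀ v : HeightOneSpectrum (𝓞 F), (p : 𝓞 F) ∈ v.asIdeal →
      (V.baseChange F).HasSplitMultiplicativeReductionAt v)
    (κ : ZpExtension F p) (γ : Field.absoluteGaloisGroup F) (hκ : κ.IsCyclotomic) (hγ : κ.IsTopGenerator γ)
    (D : (V.baseChange F).SelmerDualData κ γ) [Module.Finite (IwasawaAlgebra p) D.X] (hD : D.IsTorsion) :
    (charIdeal (IwasawaAlgebra p) D.X).map (invol p).toRingHom = charIdeal (IwasawaAlgebra p) D.X := by
  obtain ⟨f, hf⟩ := (charIdeal_isPrincipal_holds p D.X).principal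
  have hchar : D.charIdeal = Ideal.span {f} := hf
  obtain ⟨u, hu⟩ := h114F F V p hF κ γ hκ hγ D hD f hchar (invSubOne p) (Greenberg1999.one_add_X_mul_invSubOne_add_one p)
  change D.charIdeal.map (invol p).toRingHom = D.charIdeal
  rw [hchar, Ideal.map_span, Set.image_singleton]
  change Ideal.span {invol p f} = Ideal.span {f}
  rw [invol_apply, hu]
  exact Ideal.span_singleton_mul_left_unit u.isUnit f

/-! ## §2 The symmetry of `X(E/ℚ_∞)` for the additive curve, from the two PRINT facts and the decomposition reading -/

/-- **T20 (a) by name: `ℓ_𝔮(X(W/ℚ_∞)) = ℓ_{ι𝔮}(X(W/ℚ_∞))` at every height-one `𝔮 ∌ 2`.** Data: `W'` globally minimal,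
multiplicative at `2` (intended: a minimal model of the split-multiplicative twist `W^{(−1)}`); a number field `F` with
`W'` split multiplicative at every place above `2` (intended: `ℚ(i)`); cyclotomic data over `F` and over `ℚ`; finitely
generated TORSION dual Selmer data `D_F` (`X(W'/F_∞)`), `D'` (`X(W'/ℚ_∞)`), `D` (`X(W/ℚ_∞)`); the decomposition reading
`hdec` in length form at the height-one primes `∌ 2`. Inputs by name: the tree's PRINT facts
`Greenberg1999_thm114_charIdeal_iota_invariant` (over `ℚ`, for `D'`) and `…_splitMult_baseChange` (over `F`, for `D_F`),
read prime by prime (`Kato2004.lengthAt_eq_comap_invol_of_map_invol_charIdeal_eq`); then cancellation of the finite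
length `ℓ(D'.X)`. [cite: GreenbergLNM1716, Thm. 1.14 (p. 68) and §1 (p. 60)] [cite: Washington1997, §13.2] -/
theorem lengthAt_selmerDual_symm_of_decomposition
    (h114 : Greenberg1999_thm114_charIdeal_iota_invariant)
    (h114F : Greenberg1999.thm114_charIdeal_iota_invariant_splitMult_baseChange)
    (W' : WeierstrassCurve ℚ) [W'.IsElliptic] [W'.IsGloballyMinimal] (hmult' : W'.HasMultiplicativeReductionAtPrime 2)
    (F : Type) [Field F] [NumberField F]
    (hF : ∀ v : HeightOneSpectrum (𝓞 F), (2 : 𝓞 F) ∈ v.asIdeal → (W'.baseChange F).HasSplitMultiplicativeReductionAt v)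
    (κF : ZpExtension F 2) (γF : Field.absoluteGaloisGroup F) (hκF : κF.IsCyclotomic) (hγF : κF.IsTopGenerator γF)
    (DF : (W'.baseChange F).SelmerDualData κF γF) [Module.Finite (IwasawaAlgebra 2) DF.X] (hDF : DF.IsTorsion)
    (κ : ZpExtension ℚ 2) (γ : Field.absoluteGaloisGroup ℚ) (hκ : κ.IsCyclotomic) (hγ : κ.IsTopGenerator γ)
    (D' : W'.SelmerDualData κ γ) [Module.Finite (IwasawaAlgebra 2) D'.X] (hD' : D'.IsTorsion)
    {W : WeierstrassCurve ℚ} (D : W.SelmerDualData κ γ)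
    (hdec : ∀ 𝔮 : PrimeSpectrum (IwasawaAlgebra 2), 𝔮.asIdeal.height = 1 →
      PowerSeries.C (2 : ℤ_[2]) ∉ 𝔮.asIdeal →
      lengthAt (IwasawaAlgebra 2) DF.X 𝔮 = lengthAt (IwasawaAlgebra 2) D'.X 𝔮 + lengthAt (IwasawaAlgebra 2) D.X 𝔮)
    (𝔮 : PrimeSpectrum (IwasawaAlgebra 2)) (h𝔮 : 𝔮.asIdeal.height = 1)
    (hp𝔮 : PowerSeries.C (2 : ℤ_[2]) ∉ 𝔮.asIdeal) :
    lengthAt (IwasawaAlgebra 2) D.X 𝔮 =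
      lengthAt (IwasawaAlgebra 2) D.X (PrimeSpectrum.comap (invol 2).toRingHom 𝔮) := by
  haveI : Fact (Nat.Prime 2) := ⟨Nat.prime_two⟩
  -- ideal forms of the two PRINT facts
  have hGF := map_invol_charIdeal_eq_of_thm114_baseChange h114F F W' 2 (by exact_mod_cast hF) κF γF hκF hγF DF hDF
  have hG' : (charIdeal (IwasawaAlgebra 2) D'.X).map (invol 2).toRingHom = charIdeal (IwasawaAlgebra 2) D'.X := by
    have h := Greenberg1999.map_invol_charIdeal_eq_of_thm114 h114 W' 2 (Or.inr hmult') κ γ hκ hγ D' hD'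
    rw [map_invol_toRingHom_eq]
    exact h
  -- the conjugate prime
  set 𝔮' := PrimeSpectrum.comap (invol 2).toRingHom 𝔮 with h𝔮'def
  have h𝔮' : 𝔮'.asIdeal.height = 1 := by rw [h𝔮'def, Kato2004.height_comap_invol]; exact h𝔮
  have hp𝔮' : PowerSeries.C (2 : ℤ_[2]) ∉ 𝔮'.asIdeal := by
    intro h
    apply hp𝔮
    rw [h𝔮'def, PrimeSpectrum.comap_asIdeal, Ideal.mem_comap] at h
    change invol 2 (PowerSeries.C (2 : ℤ_[2])) ∈ 𝔮.asIdeal at h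
    rwa [invol_C] at h
  -- prime-by-prime symmetry of `D_F.X` and `D'.X`
  have hsF := Kato2004.lengthAt_eq_comap_invol_of_map_invol_charIdeal_eq hDF hGF 𝔮 h𝔮
  have hs' := Kato2004.lengthAt_eq_comap_invol_of_map_invol_charIdeal_eq hD' hG' 𝔮 h𝔮
  have hfin' : lengthAt (IwasawaAlgebra 2) D'.X 𝔮' ≠ ⊤ :=
    IwasawaAlgebra.lengthAt_ne_top_of_isTorsion D'.X hD' 𝔮' (le_of_eq h𝔮')
  have h1 := hdec 𝔮 h𝔮 hp𝔮
  have h2 := hdec 𝔮' h𝔮' hp𝔮'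
  rw [hsF, h2, hs'] at h1
  exact ((add_right_inj_of_ne_top hfin').mp h1).symm

/-! ## §3 Kato's divisibility at every height-one `𝔮 ∌ 2` for the additive (−1)-block, the decomposition as the one Selmer-side reading -/

/-- **`ℓ_𝔮(X(W/ℚ_∞)) ≤ ℓ_𝔮(Λ/(L̃))` at EVERY height-one `𝔮 ∌ 2` for `W` additive at `2` with `W^{(−1)}` split multiplicative
and `W[2]` irreducible**, from: `Kato2004.thm12_4` (PRINT), the typed input `KatoOddBranchInputsAtTwoNegOneSplitTwist` (T20 (b)),
the two PRINT facts `Greenberg1999_thm114_charIdeal_iota_invariant` / `…_splitMult_baseChange` applied to a globally minimal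
model `W'` of the twist over `ℚ` and over `F` (intended `ℚ(i)`), the twist-decomposition READING in length form (`hdec`,
T20 (a)), the torsion of `X(W'/F_∞)` and `X(W'/ℚ_∞)` (Kato–Rohrlich; the multiplicative lane's K11b), and the functional
equation `(ι L̃) = (L̃)` of an integral multiple `L̃ = 2^m·L⁻ ≠ 0` of the odd branch (T20 (d)). This is T20 (e) in the
`X`-currency with every Selmer-side step BY NAME except the decomposition.
[cite: Kato2004Asterisque, Thm. 12.4 (2) (p. 221), Thm. 12.5 (3) and (12.5.1) (p. 222), Conj. 17.6 (p. 274), §17.13 (pp. 279–280)]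
[cite: GreenbergLNM1716, Thm. 1.14 (p. 68)] [cite: MazurTateTeitelbaum1986Invent, §I.17] -/
theorem lengthAt_selmerDual_le_of_oddBranchInputs_of_decomposition (h12 : Kato2004.thm12_4)
    (hOB : KatoOddBranchInputsAtTwoNegOneSplitTwist)
    (h114 : Greenberg1999_thm114_charIdeal_iota_invariant)
    (h114F : Greenberg1999.thm114_charIdeal_iota_invariant_splitMult_baseChange)
    (W : WeierstrassCurve ℚ) [W.IsElliptic] [W.IsGloballyMinimal] [ContinuousSMul ℤ_[2] (W.tateModule 2)]
    {N : ℕ} [NeZero N] (f : CuspForm (Gamma0 N) 2) (κ : ZpExtension ℚ 2) (γ : absoluteGaloisGroup ℚ)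
    (hsp : (W.quadraticTwist (-1)).HasSplitMultiplicativeReductionAtPrime 2)
    (hirr : W.HasIrreducibleModPGaloisRep 2) (hκ : κ.IsCyclotomic) (hγ : κ.IsTopGenerator γ)
    (hγ' : IsCyclotomicVariable 2 γ) (hf : IsNewformOf (W.quadraticTwist (-1)) f)
    (I : Kato2004.IwasawaH1Data W 2 κ γ) (D : W.SelmerDualData κ γ)
    -- the twist over `ℚ` and over `F`, with the decomposition reading in length form
    (W' : WeierstrassCurve ℚ) [W'.IsElliptic] [W'.IsGloballyMinimal] (hmult' : W'.HasMultiplicativeReductionAtPrime 2)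
    (F : Type) [Field F] [NumberField F]
    (hF : ∀ v : HeightOneSpectrum (𝓞 F), (2 : 𝓞 F) ∈ v.asIdeal → (W'.baseChange F).HasSplitMultiplicativeReductionAt v)
    (κF : ZpExtension F 2) (γF : Field.absoluteGaloisGroup F) (hκF : κF.IsCyclotomic) (hγF : κF.IsTopGenerator γF)
    (DF : (W'.baseChange F).SelmerDualData κF γF) [Module.Finite (IwasawaAlgebra 2) DF.X] (hDF : DF.IsTorsion)
    (D' : W'.SelmerDualData κ γ) [Module.Finite (IwasawaAlgebra 2) D'.X] (hD' : D'.IsTorsion)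
    (hdec : ∀ 𝔮 : PrimeSpectrum (IwasawaAlgebra 2), 𝔮.asIdeal.height = 1 →
      PowerSeries.C (2 : ℤ_[2]) ∉ 𝔮.asIdeal →
      lengthAt (IwasawaAlgebra 2) DF.X 𝔮 = lengthAt (IwasawaAlgebra 2) D'.X 𝔮 + lengthAt (IwasawaAlgebra 2) D.X 𝔮)
    -- the `2`-adic `L`-function side
    (Lt : IwasawaAlgebra 2) (m : ℕ)
    (hLt : iwasawaToPowerSeries 2 Lt =
      PowerSeries.C ((2 : ℚ_[2]) ^ m) * padicLFunctionMinusBranchMult f (1 : ℚ_[2]) 1)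
    (hLt0 : Lt ≠ 0) (hLtι : (Ideal.span {Lt}).map (invol 2).toRingHom = Ideal.span {Lt})
    (𝔮 : PrimeSpectrum (IwasawaAlgebra 2)) (h𝔮 : 𝔮.asIdeal.height = 1)
    (hp𝔮 : PowerSeries.C (2 : ℤ_[2]) ∉ 𝔮.asIdeal) :
    lengthAt (IwasawaAlgebra 2) D.X 𝔮 ≤
      lengthAt (IwasawaAlgebra 2) (IwasawaAlgebra 2 ⧸ Ideal.span {Lt}) 𝔮 := by
  obtain ⟨π, hπ, K, -, -⟩ := hOB W f κ γ hsp hirr hκ hγ hγ' hf I D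
  have hp2 : ((2 : ℕ) : ℚ_[2]) = (2 : ℚ_[2]) := by norm_num
  have hLt' : iwasawaToPowerSeries 2 Lt =
      PowerSeries.C (((2 : ℕ) : ℚ_[2]) ^ m) * padicLFunctionMinusBranchMult f (1 : ℚ_[2]) 1 := by
    rw [hp2]; exact hLt
  have hp𝔮' : PowerSeries.C ((2 : ℕ) : ℤ_[2]) ∉ 𝔮.asIdeal := by exact_mod_cast hp𝔮
  have hdich : π ∉ 𝔮.asIdeal ∨ π ∉ (PrimeSpectrum.comap (invol 2).toRingHom 𝔮).asIdeal := by
    rcases hπ with rfl | rfl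
    · exact not_mem_comap_invol_of_mem_five_X_add_four 𝔮 hp𝔮
    · exact not_mem_comap_invol_of_mem_X_sub_four 𝔮 hp𝔮
  rcases hdich with hoff | hat
  · exact K.lengthAt_X_le_off_factor h12 hκ hγ hLt' hLt0 𝔮 h𝔮 hp𝔮' hoff
  · have hXsym := lengthAt_selmerDual_symm_of_decomposition h114 h114F W' hmult' F hF κF γF hκF hγF DF hDF
      κ γ hκ hγ D' hD' D hdec 𝔮 h𝔮 hp𝔮
    exact K.lengthAt_X_le_at_factor_of_lengthAt_symm h12 hκ hγ hLt' hLt0 𝔮 h𝔮 hp𝔮' hat hXsym hLtι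

end Summit.BirchSwinnertonDyer.BirchSwinnertonDyer.Theorems.AddKatoTwo

end
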